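import Literature.Algebra.Homology.HomogeneousCochainsPartialProd
import HarnessLib

/-!
# An inhomogeneous coboundary is an EQUIVARIANT homogeneous coboundary — crux HeckeEigenvalueField
# (stmt-Langlands-13632), line Sketch, stub `stub_homogeneous_of_inhomogeneous_coboundary`

Statement.  Let `A` be a `k`-linear representation of a group `G`, `F : (Fin (q+2) → G) → A` a
`G`-equivariant HOMOGENEOUS `(q+1)`-cochain (`F(γ P₀, …, γ P_{q+1}) = γ • F(P₀, …, P_{q+1})`), and suppose
its inhomogeneous cochain `F ∘ Fin.partialProd` (the classical dictionary
`f(g₁, …, g_{q+1}) = F(1, g₁, g₁g₂, …)`, [cite: Brown1982CohomologyGroups, III §1 (p. 59), I §5]) is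
Mathlib's inhomogeneous coboundary `inhomogeneousCochains.d A q y` of some `y : (Fin q → G) → A`.
Then `F = δH` — `F P = ∑ᵢ (-1)ⁱ H(P ∘ Fin.succAbove i)` for every `P` — for an EQUIVARIANT homogeneous
`q`-cochain `H`, namely `H(g₀, …, g_q) = g₀ • y(g₀⁻¹g₁, g₁⁻¹g₂, …, g_{q-1}⁻¹g_q)`.

Proof.  (i) `H` is equivariant: the consecutive ratios `gᵢ⁻¹ gᵢ₊₁` are unchanged under `g ↦ γ g` and
`ρ(γ g₀) = ρ(γ) ρ(g₀)`.  (ii) `H ∘ partialProd = y`: the first partial product is `1` and the consecutive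
ratios of `partialProd g'` are the `g'ᵢ` (`Fin.partialProd_right_inv`).  (iii) By the dictionary identity
of the tree (`Literature.Algebra.Homology.inhomogeneousCochains_d_comp_partialProd`), for equivariant `H`
one has `(δH)(partialProd g) = d (H ∘ partialProd) g = d y g = F(partialProd g)`.  (iv) Every tuple is a
left translate of a partial-product tuple, `P = P₀ • partialProd (Pᵢ⁻¹ Pᵢ₊₁)ᵢ`
(`Fin.partialProd_left_inv`), and both `F` and `δH` are equivariant, so they agree on `P`.
This is the converse companion of the tree's `comp_partialProd_eq_d_comp_partialProd`.

Theorems only (no definitions, no named facts).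
-/

set_option linter.dupNamespace false -- project-wide: `Summit.Langlands.Langlands` is the mandated namespace

noncomputable section

open CategoryTheory Literature.Algebra.Homology

namespace Summit.Langlands.Langlands.Theorems.HeckeEigenvalueField.Res

section Helpers

variable {k G : Type} [CommRing k] [Group G] (A : Rep k G) {q : ℕ}

/-- The consecutive ratios `gᵢ⁻¹ gᵢ₊₁` of a tuple are invariant under left translation `g ↦ γ g`.
[folklore] -/
theorem ratios_mul_left (γ : G) (g : Fin (q + 1) → G) :
    (fun i : Fin q => (γ * g (Fin.castSucc i))⁻¹ * (γ * g i.succ)) =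
      fun i : Fin q => (g (Fin.castSucc i))⁻¹ * g i.succ := by
  funext i
  rw [mul_inv_rev, mul_assoc, inv_mul_cancel_left]

/-- **Equivariance of the homogenisation** `H(g₀, …, g_q) = g₀ • y(g₀⁻¹g₁, …, g_{q-1}⁻¹g_q)` of an
inhomogeneous cochain `y`: `H(γ g) = γ • H(g)`. [cite: Brown1982CohomologyGroups, III §1 (p. 59)] -/
theorem homogenisation_equivariant (y : (Fin q → G) → A) (γ : G) (g : Fin (q + 1) → G) :
    A.ρ (γ * g 0) (y fun i : Fin q => (γ * g (Fin.castSucc i))⁻¹ * (γ * g i.succ)) =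
      A.ρ γ (A.ρ (g 0) (y fun i : Fin q => (g (Fin.castSucc i))⁻¹ * g i.succ)) := by
  rw [ratios_mul_left, map_mul, Module.End.mul_apply]

/-- **The homogenisation restricts to `y` on partial-product tuples**:
`H(1, g₁, g₁g₂, …) = y(g₁, g₂, …)` (`Fin.partialProd_zero`, `Fin.partialProd_right_inv`).
[cite: Brown1982CohomologyGroups, III §1 (p. 59)] -/
theorem homogenisation_partialProd (y : (Fin q → G) → A) (g' : Fin q → G) :
    A.ρ (Fin.partialProd g' 0) (y fun i : Fin q =>
        (Fin.partialProd g' (Fin.castSucc i))⁻¹ * Fin.partialProd g' i.succ) = y g' := by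
  rw [Fin.partialProd_zero, map_one, Module.End.one_apply]
  congr 1
  funext i
  exact Fin.partialProd_right_inv g' i

/-- Every tuple is the left translate by its first entry of the partial products of its consecutive
ratios: `P = P₀ • partialProd (Pᵢ⁻¹ Pᵢ₊₁)ᵢ` (`Fin.partialProd_left_inv`, pointwise form). [folklore] -/
theorem mul_partialProd_ratios (P : Fin (q + 2) → G) (m : Fin (q + 2)) :
    P 0 * Fin.partialProd (fun i : Fin (q + 1) => (P (Fin.castSucc i))⁻¹ * P i.succ) m = P m := by
  have h := congrFun (Fin.partialProd_left_inv P) m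
  simpa only [Pi.smul_apply, smul_eq_mul] using h

/-- **Two equivariant homogeneous cochains that agree on partial-product tuples agree everywhere.**
[cite: Brown1982CohomologyGroups, III §1 (p. 59), I §5] -/
theorem eq_of_equivariant_of_forall_partialProd (F F' : (Fin (q + 2) → G) → A)
    (hF : ∀ (γ : G) (g : Fin (q + 2) → G), F (fun i => γ * g i) = A.ρ γ (F g))
    (hF' : ∀ (γ : G) (g : Fin (q + 2) → G), F' (fun i => γ * g i) = A.ρ γ (F' g))
    (h : ∀ g : Fin (q + 1) → G, F (Fin.partialProd g) = F' (Fin.partialProd g))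
    (P : Fin (q + 2) → G) : F P = F' P := by
  have hP : (fun m => P 0 * Fin.partialProd
      (fun i : Fin (q + 1) => (P (Fin.castSucc i))⁻¹ * P i.succ) m) = P :=
    funext (mul_partialProd_ratios P)
  calc F P = F (fun m => P 0 * Fin.partialProd
        (fun i : Fin (q + 1) => (P (Fin.castSucc i))⁻¹ * P i.succ) m) := by rw [hP]
    _ = F' (fun m => P 0 * Fin.partialProd
        (fun i : Fin (q + 1) => (P (Fin.castSucc i))⁻¹ * P i.succ) m) := by rw [hF, hF', h]
    _ = F' P := by rw [hP]

/-- **The simplicial coboundary of an equivariant homogeneous cochain is equivariant**: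
`δH(γ P) = γ • δH(P)` for `δH(P) = ∑ᵢ (-1)ⁱ H(P ∘ succAbove i)`. [folklore] -/
theorem simplicialCoboundary_equivariant (H : (Fin (q + 1) → G) → A)
    (hH : ∀ (γ : G) (g : Fin (q + 1) → G), H (fun i => γ * g i) = A.ρ γ (H g))
    (γ : G) (P : Fin (q + 2) → G) :
    (∑ i : Fin (q + 2), (-1 : k) ^ (i : ℕ) • H fun j => γ * P (i.succAbove j)) =
      A.ρ γ (∑ i : Fin (q + 2), (-1 : k) ^ (i : ℕ) • H fun j => P (i.succAbove j)) := by
  simp only [map_sum, map_smul, hH]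

/-- **Core of HOM-COB.**  If `H` is an equivariant homogeneous `q`-cochain with `H ∘ partialProd = y`
and `d y = F ∘ partialProd` for an equivariant homogeneous `F`, then `F = δH`: by the dictionary
identity `inhomogeneousCochains_d_comp_partialProd`, `δH` and `F` agree on partial-product tuples, and
both are equivariant. [cite: Brown1982CohomologyGroups, III §1 (p. 59), I §5] -/
theorem eq_simplicialCoboundary_of_d_eq (F : (Fin (q + 2) → G) → A)
    (hF : ∀ (γ : G) (g : Fin (q + 2) → G), F (fun i => γ * g i) = A.ρ γ (F g))
    (y : (Fin q → G) → A)
    (hy : (inhomogeneousCochains.d A q) y = fun g : Fin (q + 1) → G => F (Fin.partialProd g))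
    (H : (Fin (q + 1) → G) → A)
    (hH : ∀ (γ : G) (g : Fin (q + 1) → G), H (fun i => γ * g i) = A.ρ γ (H g))
    (hHy : ∀ g' : Fin q → G, H (Fin.partialProd g') = y g') (P : Fin (q + 2) → G) :
    F P = ∑ i : Fin (q + 2), (-1 : k) ^ (i : ℕ) • H (fun j => P (i.succAbove j)) := by
  refine eq_of_equivariant_of_forall_partialProd A F
    (fun P' => ∑ i : Fin (q + 2), (-1 : k) ^ (i : ℕ) • H fun j => P' (i.succAbove j)) hF
    (simplicialCoboundary_equivariant A H hH) (fun g => ?_) P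
  have hHy' : (fun g' : Fin q → G => H (Fin.partialProd g')) = y := funext hHy
  rw [← inhomogeneousCochains_d_comp_partialProd A H hH g, hHy', hy]

end Helpers

/-- **Stub HOM-COB — an inhomogeneous coboundary is an EQUIVARIANT homogeneous coboundary.**  If the
inhomogeneous cochain `F ∘ partialProd` of an equivariant homogeneous `(q+1)`-cochain `F` is Mathlib's
coboundary `d y` of some `y : (Fin q → G) → A`, then `F = δH` for the EQUIVARIANT homogeneous
`H(g₀, …, g_q) = g₀ • y(g₀⁻¹g₁, …, g_{q-1}⁻¹g_q)` (`H ∘ partialProd = y`, the partial-product dictionary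
`inhomogeneousCochains_d_comp_partialProd`, and two equivariant cochains agreeing on all tuples
`(1, g₁, g₁g₂, …)` agree).  Converse companion of `comp_partialProd_eq_d_comp_partialProd`.
[cite: Brown1982CohomologyGroups, III §1 (p. 59), I §5] -/
theorem stub_homogeneous_of_inhomogeneous_coboundary
    {k G : Type} [CommRing k] [Group G] (A : Rep k G) {q : ℕ}
    (F : (Fin (q + 2) → G) → A)
    (hF : ∀ (γ : G) (g : Fin (q + 2) → G), F (fun i => γ * g i) = A.ρ γ (F g))
    (y : (Fin q → G) → A)
    (hy : (inhomogeneousCochains.d A q) y = fun g : Fin (q + 1) → G => F (Fin.partialProd g)) :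
    ∃ H : (Fin (q + 1) → G) → A,
      (∀ (γ : G) (g : Fin (q + 1) → G), H (fun i => γ * g i) = A.ρ γ (H g)) ∧
        ∀ P : Fin (q + 2) → G,
          F P = ∑ i : Fin (q + 2), (-1 : k) ^ (i : ℕ) • H (fun j => P (i.succAbove j)) :=
  ⟨fun g => A.ρ (g 0) (y fun i : Fin q => (g (Fin.castSucc i))⁻¹ * g i.succ),
    homogenisation_equivariant A y,
    eq_simplicialCoboundary_of_d_eq A F hF y hy
      (fun g => A.ρ (g 0) (y fun i : Fin q => (g (Fin.castSucc i))⁻¹ * g i.succ))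
      (homogenisation_equivariant A y) (homogenisation_partialProd A y)⟩

end Summit.Langlands.Langlands.Theorems.HeckeEigenvalueField.Res

end
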